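import Summits.QuantumFields.YangMills.Theorems.UnitScaleTiltProp8FlatOpsLettersAssembly
import Summits.QuantumFields.YangMills.Theorems.UnitScaleTiltProp8FlatCubeOpsTextWhole
import Summits.QuantumFields.YangMills.Theorems.UnitScaleTiltProp8FlatCubeSequence
import Literature.MathematicalPhysics.QuantumFieldTheory.Balaban1983to89.B5AveragingLocalityV1
import HarnessLib

/-!
# Route `UnitScaleTilt`, crux K1 child «MinimiserStabilityRegPr» (stmt-QuantumFields-19200), v8 pillar **P2 `stub_flatOpsCubeSeq`** — the ONE row of the assembly
# `FlatOpsLettersAssembly.RowsAt` that is lattice geometry rather than analysis, PROVED: **THE AVERAGING `Q` IS A SUP-CONTRACTION** (`|(Q_ju)(c)| ≤ sup` of `|u|`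
# over the fine bonds under `Bʲ(c₋) ∪ Bʲ(c₊)`), and the contraction row `QContrLetter` DISCHARGED — for the one-level family `Domains.whole (K − n)` (`C_Q = 1`) and for
# EVERY admissible family of the text (`Adm22 D R M`, `R·M ≥ 2L`; `C_Q = L`)

Cell `ym3-torus` (HUMAN RULING D-0037, YM ladder rung R3), seat `ym3-torus-p1` gen 16.  `--supports stmt-QuantumFields-19200 --as helper`; count-neutral; def-free.

THE PRINT.  [Balaban1984PropagatorsI] (1.11) p. 19: *«(QA)(c) = Σ_{x∈B(c₋)} L^{−(d+1)} A([x, x(c)])»*, (1.8): *«A(Γ) = Σ_{b⊂Γ} A_b»*, p. 19: *«x(c) denotes a point in the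
block B(c₊) obtained by translation of x by the bond c»*; (1.18) p. 20: *«(Q_kA)_b = Σ_{x∈B^k(b₋)} η^{d+1} A([x, x(b)])»* — `(Q_ju)(c)` is an average of `L^{j(d+1)}`
values of `u` with equal weights `L^{−j(d+1)}`, all on fine bonds whose end-points lie in `Bʲ(c₋) ∪ Bʲ(c₊)` (the straight contours).  Hence the sup-contraction.
[Balaban1984PropagatorsII] (2.20) p. 226: *«(QA)(b) = (Q_jA)(b) for b ∈ Λ_j»*.

WHAT IS PROVED (sorry-free; axioms standard; no definition):
* §1 **`abs_bondAvg_le_of_local`** — one averaging step: if `|X(b′)| ≤ r` on every `j`-bond `b′` with both end-points in `B(c₋) ∪ B(c₊)`, then `|(QX)(c)| ≤ r`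
  (p21's `B5AveragingLocalityV1.runBond_blockSite_local` + counting: `L^d` offsets × `L` contour bonds × weight `L^{−(d+1)}`);
  **`abs_bondAvgIter_le_of_blocks`** — the iterate: for a set `S` of `j`-sites, if `|u(b)| ≤ r` on every fine bond whose end-points have their `j`-blocks in `S`, then
  `|(Q_ju)(c)| ≤ r` for every `j`-bond `c` with both end-points in `S` (induction on `j`, `S ↦ B⁻¹(S)`);
* §2 **`abs_Qfun_le`** — for an index bond `c ∈ Λ_{j(c)}` of a nested family `D`: `|(Qfun D u)(c)| ≤ r` whenever `|u(b)| ≤ r` on the fine bonds `b` with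
  `B^{j(c)}(b₋), B^{j(c)}(b₊) ∈ {c₋, c₊}`;
* §3 **`qContrLetter_whole`** — THE CONTRACTION ROW OF `FlatOpsLettersAssembly.RowsAt` AT THE ONE-LEVEL FAMILY `Domains.whole (K − n)` with `C_Q = 1`: there every
  level weight is `1` (`FlatCubeOpsTextWhole.levWeight_whole_eq_one`) and every index bond sits at the top level `K − n`, so the data weight is `1` too;
* §4 **`le_levOf_succ_of_adm22`** — ACROSS AN INDEX BOND THE LEVEL DROPS BY AT MOST ONE under the (2.2) separation `Adm22 D R M`, `R·M ≥ 2L` (the outer end-point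
  of a bond straddling `∂Ω_j` has its `(j−1)`-blocks in `Ω_{j−1}`: `dist_{j−1} ≤ 2L − 1 < RM` across two adjacent `j`-blocks, by p1 g15's cross-level inequality
  `FlatCubeSequence.distSite_le_blockOf`), and **`qContrLetter_of_adm22`** — THE CONTRACTION ROW FOR EVERY ADMISSIBLE FAMILY of the P2 text, `C_Q = L`.
HONEST SCOPE.  Lattice bookkeeping; NOT a claim about the mass gap.

References: T. Bałaban, CMP **95** (1984) 17–40 [Balaban1984PropagatorsI] (1.8), (1.11) p.19, (1.18) p.20; CMP **96** (1984) 223–250 [Balaban1984PropagatorsII] (2.2)–(2.4) p.224,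
(2.20) p.226; CMP **102** (1985) 277–309 [Balaban1985Variational] p.286 (the levels `j(x)`).
-/

set_option autoImplicit false

noncomputable section

open scoped BigOperators

namespace Summit.QuantumFields.YangMills.Theorems.FlatCubeQContraction

open Literature.MathematicalPhysics.QuantumFieldTheory.Balaban1983to89
open LatticeFieldCalculus (bondAvg bondAvgIter segSum runBond)
open B6SectADomainsV1 (Domains)
open B6SectAOperatorsV1 (BondIdx QE)
open B5Eq118OneStroke (iterBlockOf iterBlockOf_succ iterBlockOf_zero)
open T3ContinuumYM3Torus (T3Family)
open B5Eq117TorusCarriers (Mk)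
open B5Prop12FieldsLattice (distSite)
open B5RowSumsP12Lattice (distSite_comm)
open B11Eq115Space (levOf)
open FlatCubeOpsText (Adm22 IsLevWeight)
open FlatOpsLettersAssembly (Qfun Qfun_apply QContrLetter)

/-! ## §1 The averaging is a sup-contraction -/

section Generic

variable {P : Params} {j : ℕ}

/-- **ONE AVERAGING STEP IS A SUP-CONTRACTION, LOCALLY**: if `|X(b′)| ≤ r` for every `j`-bond `b′` whose end-points both lie in `B(c₋) ∪ B(c₊)`, then
`|(QX)(c)| ≤ r` — `(QX)(c)` is the mean of the `L^{d+1}` values `X(b′)` along the straight contours `[x, x(c)]`, `x ∈ B(c₋)`.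
[cite: Balaban1984PropagatorsI, (1.8) p.19, (1.11) p.19] -/
theorem abs_bondAvg_le_of_local (hj : j + 1 ≤ P.m + P.K) (X : VecField P j ℝ) (c : PBond P (j + 1)) {r : ℝ}
    (h : ∀ b : PBond P j, (blockOf b.src = c.src ∨ blockOf b.src = c.tgt) → (blockOf b.tgt = c.src ∨ blockOf b.tgt = c.tgt) → |X b| ≤ r) :
    |bondAvg X c| ≤ r := by
  have hLpos : (0 : ℝ) < (P.L : ℝ) := Nat.cast_pos.2 P.L_pos
  have hLd : (0 : ℝ) < (P.L : ℝ) ^ (P.d + 1) := pow_pos hLpos _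
  -- every contour bond is local, so every summand is bounded by `r`
  have hseg : ∀ rr : Fin P.d → Fin P.L, |segSum X (Site.blockSite c.src rr) c.dir P.L| ≤ (P.L : ℝ) * r := by
    intro rr
    unfold segSum
    calc |∑ t ∈ Finset.range P.L, X (runBond (Site.blockSite c.src rr) c.dir t)|
        ≤ ∑ t ∈ Finset.range P.L, |X (runBond (Site.blockSite c.src rr) c.dir t)| := Finset.abs_sum_le_sum_abs _ _
      _ ≤ ∑ _t ∈ Finset.range P.L, r := Finset.sum_le_sum fun t ht => by
          have hl := B5AveragingLocalityV1.runBond_blockSite_local hj c rr (Finset.mem_range.mp ht)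
          exact h _ hl.1 hl.2
      _ = (P.L : ℝ) * r := by rw [Finset.sum_const, Finset.card_range, nsmul_eq_mul]
  unfold bondAvg
  rw [smul_eq_mul, abs_mul, abs_inv, abs_of_pos hLd]
  calc ((P.L : ℝ) ^ (P.d + 1))⁻¹ * |∑ rr : Fin P.d → Fin P.L, segSum X (Site.blockSite c.src rr) c.dir P.L|
      ≤ ((P.L : ℝ) ^ (P.d + 1))⁻¹ * ∑ rr : Fin P.d → Fin P.L, |segSum X (Site.blockSite c.src rr) c.dir P.L| :=
        mul_le_mul_of_nonneg_left (Finset.abs_sum_le_sum_abs _ _) (inv_nonneg.2 hLd.le)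
    _ ≤ ((P.L : ℝ) ^ (P.d + 1))⁻¹ * ∑ _rr : Fin P.d → Fin P.L, (P.L : ℝ) * r :=
        mul_le_mul_of_nonneg_left (Finset.sum_le_sum fun rr _ => hseg rr) (inv_nonneg.2 hLd.le)
    _ = r := by
        rw [Finset.sum_const, Finset.card_univ, Fintype.card_fun, Fintype.card_fin, Fintype.card_fin, nsmul_eq_mul]
        push_cast
        field_simp
        ring

/-- **THE ITERATED AVERAGE `Q_j` IS A SUP-CONTRACTION, BLOCKWISE**: for a set `S` of `j`-sites, if `|u(b)| ≤ r` for every fine bond `b` with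
`Bʲ(b₋) ∈ S` and `Bʲ(b₊) ∈ S`, then `|(Q_ju)(c)| ≤ r` for every `j`-bond `c` with `c₋, c₊ ∈ S` (induction on `j`: the contours of (1.11) stay in
`B(c₋) ∪ B(c₊)`, (1.18) is the `j`-fold composition). [cite: Balaban1984PropagatorsI, (1.11) p.19, (1.18) p.20] -/
theorem abs_bondAvgIter_le_of_blocks :
    ∀ (j : ℕ), j ≤ P.m + P.K → ∀ (S : Set (Site P j)) (u : VecField P 0 ℝ) (r : ℝ),
      (∀ b : PBond P 0, iterBlockOf j b.src ∈ S → iterBlockOf j b.tgt ∈ S → |u b| ≤ r) →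
      ∀ c : PBond P j, c.src ∈ S → c.tgt ∈ S → |bondAvgIter j u c| ≤ r
  | 0, _, S, u, r, h, c, hs, ht => by
    change |u c| ≤ r
    exact h c (by simpa using hs) (by simpa using ht)
  | j + 1, hj, S, u, r, h, c, hs, ht => by
    change |bondAvg (bondAvgIter j u) c| ≤ r
    refine abs_bondAvg_le_of_local hj (bondAvgIter j u) c fun b' hb's hb't => ?_
    refine abs_bondAvgIter_le_of_blocks j (Nat.le_of_succ_le hj) {y : Site P j | blockOf y = c.src ∨ blockOf y = c.tgt} u r
      (fun b hbs hbt => h b ?_ ?_) b' hb's hb't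
    · rcases hbs with hbs | hbs
      · rw [iterBlockOf_succ, hbs]; exact hs
      · rw [iterBlockOf_succ, hbs]; exact ht
    · rcases hbt with hbt | hbt
      · rw [iterBlockOf_succ, hbt]; exact hs
      · rw [iterBlockOf_succ, hbt]; exact ht

end Generic

/-! ## §2 The contraction at an index bond of a nested family -/

section Idx

variable {P : Params} (D : Domains P)

/-- **`|(Qfun D u)(c)| ≤ r` AT AN INDEX BOND `c ∈ Λ_{j(c)}`** whenever `|u(b)| ≤ r` on the fine bonds `b` whose end-points have their `j(c)`-blocks among the
end-points of `c` — `(Qfun D u)(c) = (Q_{j(c)}u)(c)` ((2.20)) and §1. [cite: Balaban1984PropagatorsII, (2.20) p.226; Balaban1984PropagatorsI, (1.18) p.20] -/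
theorem abs_Qfun_le (u : PBond P 0 → ℝ) (c : BondIdx D) {r : ℝ}
    (h : ∀ b : PBond P 0, (iterBlockOf (c.1.1 : ℕ) b.src = c.1.2.src ∨ iterBlockOf (c.1.1 : ℕ) b.src = c.1.2.tgt) →
      (iterBlockOf (c.1.1 : ℕ) b.tgt = c.1.2.src ∨ iterBlockOf (c.1.1 : ℕ) b.tgt = c.1.2.tgt) → |u b| ≤ r) :
    |Qfun D u c| ≤ r := by
  rw [Qfun_apply, B6SectAOperatorsV1.QE_apply]
  have hj : (c.1.1 : ℕ) ≤ P.m + P.K := le_trans (Nat.lt_succ_iff.1 c.1.1.isLt) D.hk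
  exact abs_bondAvgIter_le_of_blocks (c.1.1 : ℕ) hj {y | y = c.1.2.src ∨ y = c.1.2.tgt} (WithLp.ofLp (WithLp.toLp 2 u)) r
    (fun b hbs hbt => h b hbs hbt) c.1.2 (Or.inl rfl) (Or.inr rfl)

end Idx

/-! ## §3 The contraction row of `RowsAt` at the one-level family `Domains.whole (K − n)`: `C_Q = 1` -/

section Whole

variable (F : T3Family) (n K : ℕ)

/-- **THE CONTRACTION ROW AT THE ONE-LEVEL FAMILY, `C_Q = 1`**: for `D := Domains.whole (K − n)` every P2 level weight is `1` and every index bond is at the top level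
`K − n`, so `QContrLetter` reads `|u| ≤ r ⇒ |(Q_{K−n}u)(c)| ≤ r` — the sup-contraction of §1.
[cite: Balaban1984PropagatorsI, (1.18) p.20; Balaban1984PropagatorsII, (2.1) p.224, (2.20) p.226] -/
theorem qContrLetter_whole (hk : K - n ≤ (F.P K).m + (F.P K).K) (w : ℕ → PBond (F.P K) 0 → ℝ)
    (hw : IsLevWeight F n K (Domains.whole (K - n) hk) w) : QContrLetter F n K (Domains.whole (K - n) hk) w 1 := by
  intro u r hr hu c
  have hL1 : (1 : ℝ) ≤ (F.L : ℝ) := by exact_mod_cast F.hL.2.le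
  have hL0 : (0 : ℝ) < (F.L : ℝ) := lt_of_lt_of_le zero_lt_one hL1
  -- the data weight at `c` is `L^{j(c)}·L^{−(K−n)} ≤ 1` since `j(c) ≤ k = K − n`
  have hjc : (c.1.1 : ℕ) ≤ K - n := Nat.lt_succ_iff.1 c.1.1.isLt
  have hwt : (F.L : ℝ) ^ ((c.1.1 : ℕ)) * ((F.L : ℝ)⁻¹) ^ (K - n) ≤ 1 := by
    rw [inv_pow, ← div_eq_mul_inv, div_le_one (pow_pos hL0 _)]
    exact pow_le_pow_right₀ hL1 hjc
  have hwt0 : 0 ≤ (F.L : ℝ) ^ ((c.1.1 : ℕ)) * ((F.L : ℝ)⁻¹) ^ (K - n) := by positivity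
  -- every fine bond has weight `1`, so `|u| ≤ r` everywhere
  have hu' : ∀ b : PBond (F.P K) 0, |u b| ≤ r := fun b => by
    have := hu b
    rwa [FlatCubeOpsTextWhole.levWeight_whole_eq_one F n K hk w hw 1 b, one_mul] at this
  have hQ : |Qfun (Domains.whole (K - n) hk) u c| ≤ r := abs_Qfun_le _ u c fun b _ _ => hu' b
  calc (F.L : ℝ) ^ ((c.1.1 : ℕ)) * ((F.L : ℝ)⁻¹) ^ (K - n) * |Qfun (Domains.whole (K - n) hk) u c|
      ≤ 1 * r := mul_le_mul hwt hQ (abs_nonneg _) zero_le_one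
    _ = 1 * r := rfl

end Whole


/-! ## §4 The contraction row for a GENERAL admissible family: across an index bond the level drops by at most one, `C_Q = L` -/

section Adm

variable {P : Params}

/-- nearest neighbours of a Setup torus are at sup circular distance `≤ 1`. [folklore] -/
theorem distSite_shift_le_one {j : ℕ} (s : Site P j) (μ : Fin P.d) : distSite (Mk P j) s (s.shift μ) ≤ 1 := by
  unfold distSite
  have h : (Finset.univ.sup fun ν : Fin P.d => ((s ν - (s.shift μ) ν).valMinAbs).natAbs) ≤ 1 := by
    refine Finset.sup_le fun ν _ => ?_
    by_cases hν : ν = μ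
    · subst hν
      have hv : s ν - (s.shift ν) ν = ((-1 : ℤ) : ZMod (P.sitesPerDir j)) := by
        simp [Site.shift]
      have hmin := ZMod.natAbs_min_of_le_div_two (P.sitesPerDir j) ((s ν - (s.shift ν) ν).valMinAbs) (-1)
        (by rw [ZMod.coe_valMinAbs, hv]) (ZMod.natAbs_valMinAbs_le _)
      simpa using hmin
    · have h0 : s ν - (s.shift μ) ν = 0 := by
        simp [Site.shift, Function.update_of_ne hν]
      rw [h0, ZMod.valMinAbs_zero]
      simp
  exact_mod_cast h

/-- the two end-points of a bond are at distance `≤ 1` from each other, in either order. [folklore] -/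
theorem distSite_endpoints_le_one {j : ℕ} (cb : PBond P j) {y y' : Site P j} (hy : y = cb.src ∨ y = cb.tgt) (hy' : y' = cb.src ∨ y' = cb.tgt) :
    distSite (Mk P j) y' y ≤ 1 := by
  have h01 : distSite (Mk P j) cb.src cb.tgt ≤ 1 := distSite_shift_le_one cb.src cb.dir
  rcases hy with rfl | rfl <;> rcases hy' with rfl | rfl
  · rw [B5Prop12FieldsLattice.distSite_self]; exact zero_le_one
  · rw [distSite_comm]; exact h01
  · exact h01
  · rw [B5Prop12FieldsLattice.distSite_self]; exact zero_le_one

variable (D : Domains P)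

/-- **ACROSS AN INDEX BOND THE LEVEL DROPS BY AT MOST ONE** (under the (2.2) separation `Adm22 D R M` with `R·M ≥ 2L`): if the `j`-block of a fine site `x` is an
end-point of an index bond `c ∈ Λ_j`, then `j(x) ≥ j − 1` — either that block lies in `Ω_j^{(j)}` (then `j(x) ≥ j`), or it is the outer end-point of a bond straddling
`∂Ω_j`, and then its `(j−1)`-blocks lie in `Ω_{j−1}` because `dist_{j−1}(Ω_j, Ω_{j−1}ᶜ) > RM ≥ 2L > 2L − 1 ≥` the `(j−1)`-distance across two adjacent `j`-blocks.
[cite: Balaban1984PropagatorsII, (2.2)-(2.4) p.224; Balaban1985Variational, p.286] -/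
theorem le_levOf_succ_of_adm22 {R M : ℕ} (hAdm : Adm22 D R M) (hRM : 2 * P.L ≤ R * M) {k : ℕ} (hk : D.k = k) {j : ℕ} (hj : j ≤ D.k)
    {cb : PBond P j} (hLam : D.LamBond j cb) (x : Site P 0) (hx : iterBlockOf j x = cb.src ∨ iterBlockOf j x = cb.tgt) :
    j ≤ levOf (fun i => {y : Site P 0 | D.InOm i y}) k x + 1 := by
  classical
  subst hk
  obtain ⟨hOm, -, -⟩ := hLam
  by_cases hin : D.InOm j x
  · exact Nat.le_succ_of_le (B11Eq115Space.le_levOf (Ω := fun i => {y : Site P 0 | D.InOm i y}) hj hin)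
  · -- the block `y = Bʲ(x)` is the end-point OUTSIDE `Ω_j`; the other end-point `y′` is inside
    have hy_out : iterBlockOf j x ∉ D.Om j := hin
    obtain ⟨y', hy'Om, hy'⟩ : ∃ y' : Site P j, y' ∈ D.Om j ∧ (y' = cb.src ∨ y' = cb.tgt) := by
      rcases hOm with h | h
      · exact ⟨cb.src, h, Or.inl rfl⟩
      · exact ⟨cb.tgt, h, Or.inr rfl⟩
    cases j with
    | zero => exact Nat.zero_le _
    | succ j₀ =>
      have hj₀ : j₀ + 1 ≤ P.m + P.K := hj.trans D.hk
      -- the `j₀`-block of `x` lies in `Ω_{j₀}`: else (2.2) at level `j₀` puts it at distance `> RM ≥ 2L` from the `j₀`-sites over `y′`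
      have hin₀ : D.InOm j₀ x := by
        by_contra hz
        set z : Site P j₀ := iterBlockOf j₀ x with hzdef
        have hzOm : z ∉ D.Om j₀ := hz
        set z'' : Site P j₀ := Site.blockSite y' (fun _ => ⟨0, P.L_pos⟩) with hz''def
        have hbz'' : blockOf z'' = y' := Site.blockOf_blockSite hj₀ y' _
        have hsep := hAdm.2 j₀ z'' z (by rw [hbz'']; exact hy'Om) hzOm
        have hbz : blockOf z = iterBlockOf (j₀ + 1) x := by rw [hzdef, iterBlockOf_succ]
        have hyy : distSite (Mk P (j₀ + 1)) (blockOf z'') (blockOf z) ≤ 1 := by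
          rw [hbz'', hbz]
          exact distSite_endpoints_le_one cb hx hy'
        have hup := FlatCubeSequence.distSite_le_blockOf hj₀ z'' z
        have hL1 : (1 : ℝ) ≤ (P.L : ℝ) := by exact_mod_cast P.L_pos
        have hRM' : (2 : ℝ) * (P.L : ℝ) ≤ ((R * M : ℕ) : ℝ) := by exact_mod_cast hRM
        have : distSite (Mk P j₀) z'' z ≤ 2 * (P.L : ℝ) - 1 := by
          calc distSite (Mk P j₀) z'' z ≤ (P.L : ℝ) * distSite (Mk P (j₀ + 1)) (blockOf z'') (blockOf z) + ((P.L : ℝ) - 1) := hup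
            _ ≤ (P.L : ℝ) * 1 + ((P.L : ℝ) - 1) := by
                gcongr
            _ = 2 * (P.L : ℝ) - 1 := by ring
        linarith
      exact Nat.succ_le_succ (B11Eq115Space.le_levOf (Ω := fun i => {y : Site P 0 | D.InOm i y}) (Nat.le_of_succ_le hj) hin₀)

end Adm

section AdmCarrier

variable (F : T3Family) (n K : ℕ) (D : Domains (F.P K))

/-- **THE CONTRACTION ROW OF `RowsAt` FOR EVERY ADMISSIBLE FAMILY, `C_Q = L`**: under `Adm22 D R M` with `R·M ≥ 2L` (and `D.k = K − n`, the text's binders), the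
P2 level weights satisfy `(L^{j(c)}η)|(Qu)(c)| ≤ L·sup_b (L^{j(b)}η)|u(b)|` — the sup-contraction of §1 and the level drop of at most one across an index bond.
[cite: Balaban1984PropagatorsII, (2.2) p.224, (2.20) p.226; Balaban1984PropagatorsI, (1.18) p.20; Balaban1985Variational, p.286] -/
theorem qContrLetter_of_adm22 (hDk : D.k = K - n) {R M : ℕ} (hAdm : Adm22 D R M) (hRM : 2 * F.L ≤ R * M)
    (w : ℕ → PBond (F.P K) 0 → ℝ) (hw : IsLevWeight F n K D w) : QContrLetter F n K D w (F.L : ℝ) := by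
  intro u r hr hu c
  have hL1 : (1 : ℝ) ≤ (F.L : ℝ) := by exact_mod_cast F.hL.2.le
  have hL0 : (0 : ℝ) < (F.L : ℝ) := lt_of_lt_of_le zero_lt_one hL1
  have hjk : (c.1.1 : ℕ) ≤ D.k := Nat.lt_succ_iff.1 c.1.1.isLt
  set ω : ℝ := (F.L : ℝ) ^ ((c.1.1 : ℕ)) * ((F.L : ℝ)⁻¹) ^ (K - n) with hω
  have hω0 : 0 < ω := by positivity
  -- on the fine bonds under the end-points of `c`: `ω·|u b| ≤ L·w₁(b)·|u b| ≤ L·r`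
  have hub : ∀ b : PBond (F.P K) 0, (iterBlockOf (c.1.1 : ℕ) b.src = c.1.2.src ∨ iterBlockOf (c.1.1 : ℕ) b.src = c.1.2.tgt) →
      |u b| ≤ (F.L : ℝ) * r / ω := by
    intro b hb
    have hlev := le_levOf_succ_of_adm22 D hAdm (by simpa using hRM) hDk hjk c.2 b.src hb
    have hwb : ω ≤ (F.L : ℝ) * w 1 b := by
      rw [hw 1 b, pow_one, hω, ← mul_assoc, ← pow_succ']
      exact mul_le_mul_of_nonneg_right (pow_le_pow_right₀ hL1 hlev) (by positivity)
    rw [le_div_iff₀ hω0]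
    calc |u b| * ω ≤ |u b| * ((F.L : ℝ) * w 1 b) := mul_le_mul_of_nonneg_left hwb (abs_nonneg _)
      _ = (F.L : ℝ) * (w 1 b * |u b|) := by ring
      _ ≤ (F.L : ℝ) * r := mul_le_mul_of_nonneg_left (hu b) hL0.le
  have hQ : |Qfun D u c| ≤ (F.L : ℝ) * r / ω := abs_Qfun_le D u c fun b hb _ => hub b hb
  have := (le_div_iff₀ hω0).1 hQ
  calc ω * |Qfun D u c| = |Qfun D u c| * ω := mul_comm _ _
    _ ≤ (F.L : ℝ) * r := this

end AdmCarrier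

end Summit.QuantumFields.YangMills.Theorems.FlatCubeQContraction

end
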